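import Summits.BirchSwinnertonDyer.BirchSwinnertonDyer.Theorems.PrintCf2RubinValueTwoEllipticUnitsTwoVariableMeasure
import HarnessLib

/-!
# de Shalit II.4.14 Step 1 / II.4.16 for the elliptic units ON `Γ_K` along a chain with VARYING step primes:
# `𝔣_{m+1} = 𝔣_m·𝔩_m` (`𝔩_m ∣ 𝔣_m`, `𝔩_m` running through the primes of `S ∪ {𝔭̄}`) — the two-variable measure on the DIAGONAL tower
# `Gal(K̄/K(𝔣_n v^{n+1}))` with `δ_{g_𝔠,N𝔠} μ = i_n(e_{𝔣_n}(𝔠))` at every level `n`, for EVERY `𝔠`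

Cell `bsd-print-cf2`, width seat `bsd-line-cf2-p1-w8` g11; `--supports` the banked S3a item stmt-BirchSwinnertonDyer-24721 (helper, Theses-free).
THEOREMS ONLY; CONDITIONAL on the published named facts `DeShalit1987.prop24_ii_galoisAction`, `prop24_iii_unit`, `prop25_i_normRelation`
(hypotheses, never asserted).

PRINT (de Shalit II.4.14 Step 1, p. 71, and II.4.16, p. 76): the measures `μ(𝔤)` for the integral ideals `𝔤` supported on the pseudo-ideal
`𝔣 = ∏_{𝔩∈S} 𝔩^∞ · 𝔭̄^∞` are compatible (II.4.12 (ii) with II.2.5 (i), ONE prime at a time) and glue to a measure on `𝒢(𝔣p^∞) = Gal(K(𝔣p^∞)/K)`.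
The sibling `…EllipticUnitsTwoVariableMeasure.exists_twoVariable_groupDistribution_ellipticUnitsGlobal` (p760222) glued along a chain
`𝔣_{m+1} = 𝔣_m·𝔩` with ONE FIXED prime `𝔩` (moduli `𝔣_0 𝔩^m`, e.g. `𝔤𝔭̄^{m+1}`): its diagonal tower reaches `Gal(K̄/K(𝔤p^∞))` only, NOT
`Gal(K̄/K(𝔣p^∞))` when `S ≠ ∅` (`RayClassTowerDiagonalSplit.lean`: every prime of `S ∪ {𝔭̄}` must occur infinitely often among the steps).
THIS file is the same theorem for ANY one-prime-step chain (`hstep : ∀ m, ∃ 𝔩, 𝔣_{m+1} = 𝔣_m·𝔩 ∧ 𝔩 ∣ 𝔣_m`; the step prime may VARY) — the proofs are those of the sibling VERBATIM, the step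
prime entering only through the one-step compatibility `pushforward_induceFrom_μ_ellipticUnitsGlobal_eq` (`N_{𝔣𝔩,𝔣} e_{𝔣𝔩}(𝔠) = e_𝔣(𝔠)`):

* ★★★ `exists_twoVariable_groupDistribution_ellipticUnitsGlobal_steps` — ∃ μ on `Γ_K` along the diagonal tower `V_n = Gal(K̄/K(𝔣_n v^{n+1}))`,
  `‖μ‖ = 1`, with `δ_{g_𝔠, N𝔠} μ = i_n(e_{𝔣_n}(𝔠))` at every level `n`, for EVERY `𝔠`, for any chain `𝔣_{m+1} = 𝔣_m 𝔩_m`, `𝔩_m ∣ 𝔣_m`;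
* ★★★ `…_of_principal_steps` — the same with the per-modulus division data discharged from principal twists.

HONEST FRAMING: an assembly of accepted kernel theorems over published named facts; nothing here closes a crux; no summit statement is proved;
BSD is not proved by any of this.

## References
* [deShalit1987] E. de Shalit, *Iwasawa theory of elliptic curves with complex multiplication* (1987), II.4.14 Step 1 (p. 71), II.4.16 (p. 76),
  II.4.12 (p. 66–69), III.1.2 Lemma (ii) (p. 89), II.4.6 (14) (p. 59), II.2.4 (ii) (p. 44), II.2.5 (i) (p. 47), I.3.4 (p. 18).
-/

-- the summit namespace `Summit.BirchSwinnertonDyer.BirchSwinnertonDyer` repeats the problem name by design (D-0017)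
set_option linter.dupNamespace false
set_option autoImplicit false

noncomputable section

open scoped Classical nonZeroDivisors
open scoped NumberField
open Field IsDedekindDomain IsDedekindDomain.HeightOneSpectrum ValuativeRel IsLocalRing MvPowerSeries
open Literature.NumberTheory.NumberFields
open Literature.NumberTheory.GaloisRepresentations Literature.NumberTheory.GaloisRepresentations.IsNonarchimedeanLocalField
  Literature.NumberTheory.GaloisRepresentations.LubinTate Literature.NumberTheory.GaloisRepresentations.ArtinLocalGlobal
  Literature.NumberTheory.PAdicHodge
open Literature.NumberTheory.EllipticCurves Literature.NumberTheory.EllipticCurves.GroupDistribution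
open Literature.NumberTheory.ComplexMultiplication.EllipticUnits
open Literature.NumberTheory.LFunctions.AbelianDensity (artinSymbol)
open Summit.BirchSwinnertonDyer.BirchSwinnertonDyer.Theorems.PrintCf2.EllipticUnitsLocal
open Summit.BirchSwinnertonDyer.BirchSwinnertonDyer.Theorems.PrintCf2.EllipticUnitsGlobal
open Summit.BirchSwinnertonDyer.BirchSwinnertonDyer.Theorems.PrintCf2.EllipticUnitsGlobalCompat

namespace Summit.BirchSwinnertonDyer.BirchSwinnertonDyer.Theorems.PrintCf2.EllipticUnitsTwoVariable

variable {K : Type} [Field K] [NumberField K] {v : HeightOneSpectrum (𝓞 K)}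

attribute [local instance] GlobalNormCoherentUnits.instCommMonoid GlobalNormCoherentUnits.galAction
attribute [local instance] ltNormUniformSpace ltNormIsUniformAddGroup rk1 nF nE fintypeResidueField
attribute [local instance] RelNormCoherentUnits.instCommMonoid

variable [NumberField.IsTotallyComplex K]
  -- the prints and the global frame
  (h24ii : DeShalit1987.prop24_ii_galoisAction) (h24iii : DeShalit1987.prop24_iii_unit) (h25 : DeShalit1987.prop25_i_normRelation)
  (hK : IsImaginaryQuadratic K) (ι : K →+* ℂ)
  -- the moduli: ANY one-prime-step chain `𝔣_{m+1} = 𝔣_m 𝔩_m`, `𝔩_m ∣ 𝔣_m` (`hstep`), all rigid and prime to `v`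
  (𝔣 : ℕ → Ideal (𝓞 K)) (hle : ∀ m, 𝔣 (m + 1) ≤ 𝔣 m)
  (h𝔣0 : ∀ m, 𝔣 m ≠ ⊥) (h𝔣1 : ∀ m, 𝔣 m ≠ ⊤) (hv : ∀ m, ¬ 𝔣 m ≤ v.asIdeal) (hw : ∀ (m : ℕ) (u : (𝓞 K)ˣ), (u : 𝓞 K) - 1 ∈ 𝔣 m → u = 1)
  -- the common local datum at `v`: `π = u·2`, `σ₀`, `ε`, `θ`, `e₂`
  (hq : residueFieldCard (v.adicCompletion K) = 2)
  (h2 : (valuation (v.adicCompletion K)).IsUniformizer ((((2 : ℕ) : 𝒪[v.adicCompletion K]) : v.adicCompletion K)))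
  (u : 𝒪[v.adicCompletion K]ˣ)
  {σ₀ : absoluteGaloisGroup (v.adicCompletion K)} (hσ₀ : IsAbsArithFrob σ₀)
  {ε : (maxUnramifiedCompletion (v.adicCompletion K))ˣ}
  (hε : maxUnramifiedCompletion.galAut (v.adicCompletion K) σ₀ (ε : maxUnramifiedCompletion (v.adicCompletion K)) =
    algebraMap 𝒪[v.adicCompletion K] (maxUnramifiedCompletion (v.adicCompletion K)) (u : 𝒪[v.adicCompletion K]) *
      (ε : maxUnramifiedCompletion (v.adicCompletion K)))
  (θ : CompletedAlgClosure (v.adicCompletion K) →+* ℂ_[2])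
  (hθ1 : ∀ z : CBall (v.adicCompletion K), ‖θ (z : CompletedAlgClosure (v.adicCompletion K))‖ ≤ 1)
  (e₂ : v.adicCompletionIntegers K ≃+* ℤ_[2])
  (hΘe : ∀ a : 𝒪[v.adicCompletion K], (θ.comp ((CBall (v.adicCompletion K)).subtype.comp
      (algebraMap (UnrCoeff (v.adicCompletion K)) (CBall (v.adicCompletion K))))) (intToUnrCoeff (v.adicCompletion K) a) =
    padicIntCast ℂ_[2] (((e₂ : v.adicCompletionIntegers K →+* ℤ_[2]).comp
      (integerEquivAdicCompletionIntegers v).toRingHom) a))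
  -- the per-modulus local models: global witnesses `α_m = π^{f_m}`, coefficient fields `E_m ≤ E_{m+1}`, readings `j_m`, cell maps `ψ_m`
  (α : ℕ → 𝓞 K) (hα0 : ∀ m, α m ≠ 0) (hα𝔣 : ∀ m, α m - 1 ∈ 𝔣 m) (hαw : ∀ m (w : HeightOneSpectrum (𝓞 K)), w ≠ v → α m ∉ w.asIdeal)
  (f : ℕ → ℕ) (hαπ : ∀ m, ((α m : K) : v.adicCompletion K) =
    ((((u : 𝒪[v.adicCompletion K]) * ((2 : ℕ) : 𝒪[v.adicCompletion K]) : 𝒪[v.adicCompletion K]) : v.adicCompletion K)) ^ f m)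
  (E : ℕ → IntermediateField (v.adicCompletion K) (AlgebraicClosure (v.adicCompletion K)))
  [hfd : ∀ m, FiniteDimensional (v.adicCompletion K) (E m)] [hgal : ∀ m, IsGalois (v.adicCompletion K) (E m)]
  (hE : ∀ m, E m ≤ maxUnramified (v.adicCompletion K))
  (hdegE : ∀ (m : ℕ) (w : WeilGroup (v.adicCompletion K)),
    WeilGroup.toAbsGalois (v.adicCompletion K) w ∈ (E m).fixingSubgroup → (f m : ℤ) ∣ WeilGroup.deg w)
  (hEE : ∀ m, E m ≤ E (m + 1))
  (j : ∀ m : ℕ, unitBall (E m) →+* UnrCoeff (v.adicCompletion K))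
  (hj : ∀ m, (j m).comp (algebraMap (LTCoeff (v.adicCompletion K)) (unitBall (E m))) =
    (intToUnrCoeff (v.adicCompletion K)).comp (LTCoeff.of (v.adicCompletion K)).symm.toRingHom)
  (hjC : ∀ m, (algebraMap (UnrCoeff (v.adicCompletion K)) (CBall (v.adicCompletion K))).comp (j m) = unitBallToCBall (E m))
  (hjj : ∀ (m : ℕ) (y : unitBall (E m)), j (m + 1) (inclUnitBall (F := v.adicCompletion K) (hEE m) y) = j m y)
  (ψ : ∀ m n : ℕ, ↥(absRestrictNormalHom (rayClassField K (𝔣 m))).ker ⧸ (rayAdicTower (𝔪 := 𝔣 m) (h𝔣0 m) v).U n → ZMod (2 ^ (n + 1)))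
  (hψ : ∀ (m n : ℕ) (g : ↥(absRestrictNormalHom (rayClassField K (𝔣 m))).ker), g ∈ (rayAdicTower (𝔪 := 𝔣 m) (h𝔣0 m) v).U 0 →
    ψ m n ((rayAdicTower (𝔪 := 𝔣 m) (h𝔣0 m) v).proj n g) =
      PadicInt.toZModPow (n + 1) ((((Units.map (e₂ : v.adicCompletionIntegers K →+* ℤ_[2]).toMonoidHom).comp
        (rayAdicCharacter (h𝔣0 m) (hv m) (hw m)))⁻¹ g : ℤ_[2]ˣ) : ℤ_[2]))
  -- the twists: ideals `𝔠` prime to all `𝔣_m v`, ARBITRARY Galois lifts `g_𝔠 ∈ Γ_K` of their Artin symbols on every `K(𝔣_m v^{k+1})`,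
  -- elliptic-unit families at every modulus
  {I : Type*} (idl : I → Ideal (𝓞 K)) (hidl0 : ∀ i, idl i ≠ ⊥) (hidlc : ∀ i m, IsCoprime (idl i) (𝔣 m * v.asIdeal))
  (g : I → absoluteGaloisGroup K)
  (hg : ∀ (i : I) (m k : ℕ), absRestrictNormalHom (rayClassField K (𝔣 m * v.asIdeal ^ (k + 1))) (g i) =
    artinSymbol (galFrob K (rayClassField K (𝔣 m * v.asIdeal ^ (k + 1)))) (idl i))
  (x : ∀ (i : I) (m k : ℕ), rayClassField K (𝔣 m * v.asIdeal ^ (k + 1)))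
  (hx : ∀ (i : I) (m k : ℕ), IsThetaValueOne ι (𝔣 m * v.asIdeal ^ (k + 1)) (idl i)
    (algClosureEmb ι ((x i m k : rayClassField K (𝔣 m * v.asIdeal ^ (k + 1))) : AlgebraicClosure K)))
  [hN : ∀ m n, ((rayAdicTower (𝔪 := 𝔣 m) (h𝔣0 m) v).U n).Normal]
  [hNabs : ∀ m n, ((absRayAdicTower (𝔪' := 𝔣 m) (h𝔣0 m) v).U n).Normal]

set_option maxHeartbeats 1600000 in
include h24ii hj hΘe hjj hg in
/-- ★★★ **de Shalit II.4.14 Step 1 / II.4.16 ON `Γ_K` for the elliptic units, chain with VARYING step primes `𝔣_{m+1} = 𝔣_m𝔩_m`: the measures `μ(𝔣_m)` GLUE.**  In the setting of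
`…EllipticUnitsGlobalMeasure.exists_groupDistribution_twisting_eq_induceFrom_ellipticUnitsGlobal` at EVERY modulus of a chain
`𝔣_{m+1} = 𝔣_m𝔩_m` (`𝔩_m ∣ 𝔣_m`, all `𝔣_m ≠ 0, 𝒪_K` with `w_{𝔣_m} = 1`, `v ∤ 𝔣_m` — e.g. the chains through the primes of `S ∪ {𝔭̄}` of II.4.16), with local models at
`v` sharing `π = u·2, ε, σ₀, θ, e₂`, increasing coefficient fields `E_m ≤ E_{m+1}` and compatible readings `j_{m+1} ∘ ι = j_m`, ARBITRARY
Artin lifts `g_𝔠 ∈ Γ_K` (on all `K(𝔣_m v^{k+1})` at once), elliptic-unit families `x` at every modulus, per-modulus auxiliary indices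
`𝔞₁(m), 𝔞₂(m)` whose lifts fix `K(𝔣_m)` and carry the division data in the relative tower (`hgen_artin`/`hpow_artin`/`hunb_artin`/`hτ_artin`
currency), and one `𝔠₀` with `N𝔠₀ ≥ 2`: **there is a bounded distribution `μ` on `Γ_K` along the DIAGONAL tower `V_n = Gal(K̄/K(𝔣_n v^{n+1}))`,
`‖μ‖ = 1`, with `δ_{g_𝔠, N𝔠} μ = i_n(e_{𝔣_n}(𝔠))` at level `n` for EVERY `𝔠` and every `n`** — `i_n = induceFrom` of the one-`𝔓` family at
the modulus `𝔣_n`.  The compatibility input is `pushforward_induceFrom_μ_ellipticUnitsGlobal_eq` (`N_{𝔣𝔩,𝔣} e_{𝔣𝔩}(𝔠) = e_𝔣(𝔠)`, II.2.5 (i)).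
GIVEN II.2.4 (ii)/(iii), II.2.5 (i). [cite: deShalit1987, II.4.14 Step 1 (p. 71), II.4.12 (p. 66–69), III.1.2 Lemma (ii) (p. 89), II.4.6 (14) (p. 59)] -/
theorem exists_twoVariable_groupDistribution_ellipticUnitsGlobal_steps
    (hstep : ∀ m, ∃ 𝔩 : HeightOneSpectrum (𝓞 K), 𝔣 (m + 1) = 𝔣 m * 𝔩.asIdeal ∧ 𝔩.asIdeal ∣ 𝔣 m)
    (s : ℕ → ℕ) (a₁ a₂ : ℕ → I)
    (hg₁H : ∀ m, g (a₁ m) ∈ (absRestrictNormalHom (rayClassField K (𝔣 m))).ker)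
    (hg₂H : ∀ m, g (a₂ m) ∈ (absRestrictNormalHom (rayClassField K (𝔣 m))).ker)
    (hσ₁ : ∀ m, (⟨g (a₁ m), hg₁H m⟩ : ↥(absRestrictNormalHom (rayClassField K (𝔣 m))).ker) ∈
      (rayAdicTower (𝔪 := 𝔣 m) (h𝔣0 m) v).U (s m))
    (hσ₂ : ∀ m, (⟨g (a₂ m), hg₂H m⟩ : ↥(absRestrictNormalHom (rayClassField K (𝔣 m))).ker) ∈
      (rayAdicTower (𝔪 := 𝔣 m) (h𝔣0 m) v).U (s m))
    (hgen : ∀ m k, s m ≤ k → ∀ w ∈ (rayAdicTower (𝔪 := 𝔣 m) (h𝔣0 m) v).U (s m), ∃ r : ℕ,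
      (rayAdicTower (𝔪 := 𝔣 m) (h𝔣0 m) v).proj k
          ((⟨g (a₁ m), hg₁H m⟩ : ↥(absRestrictNormalHom (rayClassField K (𝔣 m))).ker) ^ r) =
        (rayAdicTower (𝔪 := 𝔣 m) (h𝔣0 m) v).proj k w)
    (hpow : ∀ m n, s m ≤ n → ∃ r : ℕ,
      orderOf ((rayAdicTower (𝔪 := 𝔣 m) (h𝔣0 m) v).proj n
        (⟨g (a₁ m), hg₁H m⟩ : ↥(absRestrictNormalHom (rayClassField K (𝔣 m))).ker)) = 2 ^ r)
    (hunb : ∀ m (r : ℕ), ∃ k, 2 ^ r ∣ orderOf ((rayAdicTower (𝔪 := 𝔣 m) (h𝔣0 m) v).proj k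
        (⟨g (a₁ m), hg₁H m⟩ : ↥(absRestrictNormalHom (rayClassField K (𝔣 m))).ker)))
    (hN1 : ∀ m, 2 ≤ Ideal.absNorm (idl (a₁ m))) (h4 : ∀ m, 4 ∣ Ideal.absNorm (idl (a₁ m)) - 1)
    (hN12 : ∀ m, Ideal.absNorm (idl (a₂ m)) = Ideal.absNorm (idl (a₁ m)))
    (hτ : ∀ m k, 0 < k → ∃ n, s m ≤ n ∧
      (⟨g (a₂ m), hg₂H m⟩ : ↥(absRestrictNormalHom (rayClassField K (𝔣 m))).ker) ^ k *
        ((⟨g (a₁ m), hg₁H m⟩ : ↥(absRestrictNormalHom (rayClassField K (𝔣 m))).ker) ^ k)⁻¹ ∉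
          (rayAdicTower (𝔪 := 𝔣 m) (h𝔣0 m) v).U n)
    (c₀ : I) (hNc₀ : 2 ≤ Ideal.absNorm (idl c₀)) :
    ∃ μ : GroupDistribution (SubgroupTower.diagonal (fun m ↦ absRayAdicTower (𝔪' := 𝔣 m) (h𝔣0 m) v)
        (fun m n ↦ absRayAdicTower_U_anti (h𝔣0 m) (h𝔣0 (m + 1)) v (hle m) n)) ℂ_[2], μ.bound = 1 ∧
      ∀ (c : I) (n : ℕ) (b : absoluteGaloisGroup K ⧸ (absRayAdicTower (𝔪' := 𝔣 n) (h𝔣0 n) v).U n),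
        (twisting (g c) (Ideal.absNorm (idl c) : ℂ_[2]) μ).μ n b =
        (GroupDistribution.induceFrom (Γ := absoluteGaloisGroup K) (fun k ↦ rayAdicTower_U_eq_subgroupOf (𝔪 := 𝔣 n) (h𝔣0 n) v k)
          (fun b : GlobalNormCoherentUnits (h𝔣0 n) v ↦
            localMeasureFamily (h𝔣0 n) (hv n) (hw n) hq h2 u (E n) (hE n) hσ₀ hε θ hθ1 (j n) (hjC n) e₂ (ψ n) (hψ n)
              (RelNormCoherentUnits.ofGlobalUnits (h𝔣0 n) (hv n) (hw n) (isUniformizer_unit_mul h2 u) (hα0 n) (hα𝔣 n) (hαw n)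
                (hαπ n) (E n) (hE n) (hdegE n) b))
          zero_le_one (fun _ ↦ le_rfl)
          (ellipticUnitsGlobal h24iii h25 hK ι (h𝔣0 n) (h𝔣1 n) (hv n) (hw n) (hidl0 c) (hidlc c n) (x c n) (hx c n))).μ n b := by
  refine exists_glue_twisting_μ_eq_forall_of_units (p := 2) (G := absoluteGaloisGroup K)
    (𝒰 := fun m ↦ absRayAdicTower (𝔪' := 𝔣 m) (h𝔣0 m) v)
    (href := fun m n ↦ absRayAdicTower_U_anti (h𝔣0 m) (h𝔣0 (m + 1)) v (hle m) n)
    (B := fun m ↦ GlobalNormCoherentUnits (h𝔣0 m) v)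
    (fun m n x y ↦ commutator_mem_absRayAdicTower_U (h𝔣0 m) v n x y) _ (fun m γ b n a ↦ ?_) (fun m b b' n a ↦ ?_)
    (fun m c ↦ ellipticUnitsGlobal h24iii h25 hK ι (h𝔣0 m) (h𝔣1 m) (hv m) (hw m) (hidl0 c) (hidlc c m) (x c m) (hx c m)) g
    (fun c ↦ Ideal.absNorm (idl c)) (fun m a c ↦ ?_) s a₁ a₂
    (fun m ↦ (mem_U_coe_iff (fun k ↦ rayAdicTower_U_eq_subgroupOf (𝔪 := 𝔣 m) (h𝔣0 m) v k) (s m) ⟨g (a₁ m), hg₁H m⟩).mpr (hσ₁ m))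
    (fun m ↦ (mem_U_coe_iff (fun k ↦ rayAdicTower_U_eq_subgroupOf (𝔪 := 𝔣 m) (h𝔣0 m) v k) (s m) ⟨g (a₂ m), hg₂H m⟩).mpr (hσ₂ m))
    (fun m ↦ hgen_of_subgroup (fun k ↦ rayAdicTower_U_eq_subgroupOf (𝔪 := 𝔣 m) (h𝔣0 m) v k)
      (absRayAdicTower_U_le_ker (h𝔣0 m) v le_rfl (s m)) ⟨g (a₁ m), hg₁H m⟩ (hgen m))
    (fun m ↦ hpow_of_subgroup (fun k ↦ rayAdicTower_U_eq_subgroupOf (𝔪 := 𝔣 m) (h𝔣0 m) v k) ⟨g (a₁ m), hg₁H m⟩ (hpow m))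
    (fun m ↦ hunb_of_subgroup (fun k ↦ rayAdicTower_U_eq_subgroupOf (𝔪 := 𝔣 m) (h𝔣0 m) v k) ⟨g (a₁ m), hg₁H m⟩ (hunb m))
    hN1 (fun m ↦ dvd_trans ⟨2, rfl⟩ (h4 m)) (fun m _ ↦ h4 m) hN12
    (fun m ↦ hτ_of_subgroup (fun k ↦ rayAdicTower_U_eq_subgroupOf (𝔪 := 𝔣 m) (h𝔣0 m) v k) ⟨g (a₁ m), hg₁H m⟩ ⟨g (a₂ m), hg₂H m⟩
      (hτ m))
    zero_le_one (fun _ ↦ le_rfl) c₀ hNc₀ (fun m n a ↦ ?_)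
  · -- `Γ_K`-equivariance of `i_m`
    exact induceFrom_μ_smul' _ _ zero_le_one _ (absRayAdicTower_U_le_ker (h𝔣0 m) v le_rfl 0)
      (fun h b k c ↦ globalMeasureFamily_μ_smul (h𝔣0 m) (hv m) (hw m) hq h2 u (hα0 m) (hα𝔣 m) (hαw m) (hαπ m) (E m) (hE m) (hdegE m)
        hσ₀ hε θ hθ1 (j m) (hj m) (hjC m) e₂ hΘe (ψ m) (hψ m) h b k c) γ b n a
  · -- additivity of `i_m`
    exact induceFrom_μ_mul _ _ zero_le_one _
      (fun b b' k c ↦ globalMeasureFamily_μ_mul (h𝔣0 m) (hv m) (hw m) hq h2 u (hα0 m) (hα𝔣 m) (hαw m) (hαπ m) (E m) (hE m)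
        (hdegE m) hσ₀ hε θ hθ1 (j m) (hjC m) e₂ (ψ m) (hψ m) b b' k c) b b' n a
  · -- II.2.4 (ii) in the `Γ_K`-monoid of modulus `𝔣_m`
    exact hrel_ellipticUnitsGlobal h24ii h24iii h25 hK ι (h𝔣0 m) (h𝔣1 m) (hv m) (hw m) (hidl0 a) (hidlc a m) (hidl0 c) (hidlc c m)
      (x a m) (hx a m) (x c m) (hx c m) (g a) (g c) (hg a m) (hg c m)
  · -- the compatibility across `𝔣_{m+1} = 𝔣_m 𝔩_m` (instances for `E (m+1)` put in scope explicitly: with only the `∀ m` binders,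
    -- instance search on `unitBall (E (m + 1))` does not terminate in the default budget)
    haveI : FiniteDimensional (v.adicCompletion K) (E (m + 1)) := hfd (m + 1)
    haveI : IsGalois (v.adicCompletion K) (E (m + 1)) := hgal (m + 1)
    have hjj' : (j (m + 1)).comp (inclUnitBall (F := v.adicCompletion K) (hEE m) : unitBall (E m) →+* unitBall (E (m + 1))) = j m :=
      RingHom.ext (hjj m)
    obtain ⟨𝔩, h𝔣succ, hdiv⟩ := hstep m
    exact pushforward_induceFrom_μ_ellipticUnitsGlobal_eq hq h2 u hσ₀ hε θ hθ1 e₂ hΘe (h𝔣0 m) (h𝔣1 m) (hv m) (hw m) (hα0 m) (hα𝔣 m)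
      (hαw m) (hαπ m) (E m) (hE m) (hdegE m) (j m) (hj m) (hjC m) (ψ m) (hψ m) (h𝔣0 (m + 1)) (h𝔣1 (m + 1)) (hv (m + 1)) (hw (m + 1))
      (hα0 (m + 1)) (hα𝔣 (m + 1)) (hαw (m + 1)) (hαπ (m + 1)) (E (m + 1)) (hE (m + 1)) (hdegE (m + 1)) (j (m + 1)) (hj (m + 1))
      (hjC (m + 1)) (ψ (m + 1)) (hψ (m + 1)) h𝔣succ (hle m) hdiv (hEE m) hjj' h24iii h25 hK ι (hidl0 c₀) (hidlc c₀ m)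
      (hidlc c₀ (m + 1)) (x c₀ m) (hx c₀ m) (x c₀ (m + 1)) (hx c₀ (m + 1)) n a

set_option maxHeartbeats 1600000 in
include h24ii hj hΘe hjj hg in
/-- ★★★ **The same (varying step primes) with the per-modulus division data DISCHARGED from principal twists** (the two-variable twin of
`…EllipticUnitsGlobalMeasure.exists_groupDistribution_twisting_eq_induceFrom_ellipticUnitsGlobal_of_principal`): if at every modulus `𝔣_m`
the twist family contains two PRINCIPAL twists `𝔞₁(m) = (α₁(m))`, `𝔞₂(m) = (α₂(m))` with `αᵢ(m) ≡ 1 mod 𝔣_m`,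
`α₁(m) − 1 ∈ v^{s_m+1} ∖ v^{s_m+2}` (`1 ≤ s_m`), `α₂(m) − 1 ∈ v^{s_m+1}`, `α₂(m)ᵏ ≠ α₁(m)ᵏ` in `K_v` (`k > 0`), `N𝔞₁(m) = N𝔞₂(m) ≥ 2`,
`4 ∣ N𝔞₁(m) − 1` — the lifts `g_𝔠` of the WHOLE family arbitrary — then de Shalit's two-variable measure on `Γ_K` along the diagonal
tower exists with `δ_{g_𝔠, N𝔠} μ = i_n(e_{𝔣_n}(𝔠))` for every `𝔠` and `n`: the division data are produced per modulus for the canonical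
lifts of `((αᵢ(m)), ·)` (`artin_mem_rayAdicTower_U_iff` / `hgen_artin` / `hpow_artin` / `hunb_artin` / `hτ_artin`) and transported to
`g_{𝔞ᵢ(m)}` (any two lifts of the same Artin symbols have the same cells).  GIVEN II.2.4 (ii)/(iii), II.2.5 (i).
[cite: deShalit1987, II.4.14 Step 1 (p. 71), II.4.12 (p. 66–69), II.4.17 (p. 77–78)] [cite: NeukirchANT1999, Ch. VI §7 Thm. (7.1)] -/
theorem exists_twoVariable_groupDistribution_ellipticUnitsGlobal_of_principal_steps
    (hstep : ∀ m, ∃ 𝔩 : HeightOneSpectrum (𝓞 K), 𝔣 (m + 1) = 𝔣 m * 𝔩.asIdeal ∧ 𝔩.asIdeal ∣ 𝔣 m)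
    (s : ℕ → ℕ) (hs : ∀ m, 1 ≤ s m) (a₁ a₂ : ℕ → I) (α₁ α₂ : ℕ → 𝓞 K)
    (ha₁ : ∀ m, idl (a₁ m) = Ideal.span {α₁ m}) (ha₂ : ∀ m, idl (a₂ m) = Ideal.span {α₂ m})
    (hα₁𝔣 : ∀ m, α₁ m - 1 ∈ 𝔣 m) (hα₂𝔣 : ∀ m, α₂ m - 1 ∈ 𝔣 m)
    (hs₁ : ∀ m, α₁ m - 1 ∈ v.asIdeal ^ (s m + 1)) (hs₁' : ∀ m, α₁ m - 1 ∉ v.asIdeal ^ (s m + 2))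
    (hs₂ : ∀ m, α₂ m - 1 ∈ v.asIdeal ^ (s m + 1))
    (hne : ∀ (m k : ℕ), 0 < k → ((α₂ m : K) : v.adicCompletion K) ^ k ≠ ((α₁ m : K) : v.adicCompletion K) ^ k)
    (hN1 : ∀ m, 2 ≤ Ideal.absNorm (idl (a₁ m))) (h4 : ∀ m, 4 ∣ Ideal.absNorm (idl (a₁ m)) - 1)
    (hN12 : ∀ m, Ideal.absNorm (idl (a₂ m)) = Ideal.absNorm (idl (a₁ m)))
    (c₀ : I) (hNc₀ : 2 ≤ Ideal.absNorm (idl c₀)) :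
    ∃ μ : GroupDistribution (SubgroupTower.diagonal (fun m ↦ absRayAdicTower (𝔪' := 𝔣 m) (h𝔣0 m) v)
        (fun m n ↦ absRayAdicTower_U_anti (h𝔣0 m) (h𝔣0 (m + 1)) v (hle m) n)) ℂ_[2], μ.bound = 1 ∧
      ∀ (c : I) (n : ℕ) (b : absoluteGaloisGroup K ⧸ (absRayAdicTower (𝔪' := 𝔣 n) (h𝔣0 n) v).U n),
        (twisting (g c) (Ideal.absNorm (idl c) : ℂ_[2]) μ).μ n b =
        (GroupDistribution.induceFrom (Γ := absoluteGaloisGroup K) (fun k ↦ rayAdicTower_U_eq_subgroupOf (𝔪 := 𝔣 n) (h𝔣0 n) v k)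
          (fun b : GlobalNormCoherentUnits (h𝔣0 n) v ↦
            localMeasureFamily (h𝔣0 n) (hv n) (hw n) hq h2 u (E n) (hE n) hσ₀ hε θ hθ1 (j n) (hjC n) e₂ (ψ n) (hψ n)
              (RelNormCoherentUnits.ofGlobalUnits (h𝔣0 n) (hv n) (hw n) (isUniformizer_unit_mul h2 u) (hα0 n) (hα𝔣 n) (hαw n)
                (hαπ n) (E n) (hE n) (hdegE n) b))
          zero_le_one (fun _ ↦ le_rfl)
          (ellipticUnitsGlobal h24iii h25 hK ι (h𝔣0 n) (h𝔣1 n) (hv n) (hw n) (hidl0 c) (hidlc c n) (x c n) (hx c n))).μ n b := by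
  -- per modulus: the canonical lifts `t₁, t₂` of the two principal Artin symbols, their division data, transported to `g 𝔞ᵢ(m)`
  have key : ∀ m : ℕ, ∃ (hg₁H : g (a₁ m) ∈ (absRestrictNormalHom (rayClassField K (𝔣 m))).ker)
      (hg₂H : g (a₂ m) ∈ (absRestrictNormalHom (rayClassField K (𝔣 m))).ker),
      (⟨g (a₁ m), hg₁H⟩ : ↥(absRestrictNormalHom (rayClassField K (𝔣 m))).ker) ∈ (rayAdicTower (𝔪 := 𝔣 m) (h𝔣0 m) v).U (s m) ∧
      (⟨g (a₂ m), hg₂H⟩ : ↥(absRestrictNormalHom (rayClassField K (𝔣 m))).ker) ∈ (rayAdicTower (𝔪 := 𝔣 m) (h𝔣0 m) v).U (s m) ∧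
      (∀ k, s m ≤ k → ∀ w ∈ (rayAdicTower (𝔪 := 𝔣 m) (h𝔣0 m) v).U (s m), ∃ r : ℕ,
        (rayAdicTower (𝔪 := 𝔣 m) (h𝔣0 m) v).proj k
            ((⟨g (a₁ m), hg₁H⟩ : ↥(absRestrictNormalHom (rayClassField K (𝔣 m))).ker) ^ r) =
          (rayAdicTower (𝔪 := 𝔣 m) (h𝔣0 m) v).proj k w) ∧
      (∀ n, s m ≤ n → ∃ r : ℕ,
        orderOf ((rayAdicTower (𝔪 := 𝔣 m) (h𝔣0 m) v).proj n
          (⟨g (a₁ m), hg₁H⟩ : ↥(absRestrictNormalHom (rayClassField K (𝔣 m))).ker)) = 2 ^ r) ∧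
      (∀ r : ℕ, ∃ k, 2 ^ r ∣ orderOf ((rayAdicTower (𝔪 := 𝔣 m) (h𝔣0 m) v).proj k
        (⟨g (a₁ m), hg₁H⟩ : ↥(absRestrictNormalHom (rayClassField K (𝔣 m))).ker))) ∧
      (∀ k, 0 < k → ∃ n, s m ≤ n ∧
        (⟨g (a₂ m), hg₂H⟩ : ↥(absRestrictNormalHom (rayClassField K (𝔣 m))).ker) ^ k *
          ((⟨g (a₁ m), hg₁H⟩ : ↥(absRestrictNormalHom (rayClassField K (𝔣 m))).ker) ^ k)⁻¹ ∉
            (rayAdicTower (𝔪 := 𝔣 m) (h𝔣0 m) v).U n) := by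
    intro m
    have hα0₁ : α₁ m ≠ 0 := ne_zero_of_span_singleton_eq (hidl0 (a₁ m)) (ha₁ m)
    have hα0₂ : α₂ m ≠ 0 := ne_zero_of_span_singleton_eq (hidl0 (a₂ m)) (ha₂ m)
    have hαv₁ : α₁ m ∉ v.asIdeal := not_mem_of_isCoprime_mul (hidlc (a₁ m) m) (ha₁ m)
    have hαv₂ : α₂ m ∉ v.asIdeal := not_mem_of_isCoprime_mul (hidlc (a₂ m) m) (ha₂ m)
    obtain ⟨t₁, hσ⟩ := exists_forall_absRestrictNormalHom_eq_artinHom_span_singleton (h𝔣0 m) (hv m) hα0₁ (hα₁𝔣 m) hαv₁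
    obtain ⟨t₂, hτ'⟩ := exists_forall_absRestrictNormalHom_eq_artinHom_span_singleton (h𝔣0 m) (hv m) hα0₂ (hα₂𝔣 m) hαv₂
    have ht₁𝔪 := mem_ker_of_forall_absRestrictNormalHom_eq_artinHom (h𝔣0 m) (hv m) hα0₁ (hα₁𝔣 m) hαv₁ hσ
    have ht₂𝔪 := mem_ker_of_forall_absRestrictNormalHom_eq_artinHom (h𝔣0 m) (hv m) hα0₂ (hα₂𝔣 m) hαv₂ hτ'
    have ht₁ : ∀ k : ℕ, absRestrictNormalHom (rayClassField K (𝔣 m * v.asIdeal ^ (k + 1))) t₁ =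
        artinSymbol (galFrob K (rayClassField K (𝔣 m * v.asIdeal ^ (k + 1)))) (idl (a₁ m)) := fun k ↦ by
      rw [ha₁ m, hσ (k + 1), artinHom_toPrincipalIdeal_coe _ hα0₁]
    have ht₂ : ∀ k : ℕ, absRestrictNormalHom (rayClassField K (𝔣 m * v.asIdeal ^ (k + 1))) t₂ =
        artinSymbol (galFrob K (rayClassField K (𝔣 m * v.asIdeal ^ (k + 1)))) (idl (a₂ m)) := fun k ↦ by
      rw [ha₂ m, hτ' (k + 1), artinHom_toPrincipalIdeal_coe _ hα0₂]
    have hp2 : (2 : ℕ) = 2 → 1 ≤ s m := fun _ ↦ hs m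
    -- the division data for the canonical lifts
    have dσ₁ := (artin_mem_rayAdicTower_U_iff (h𝔣0 m) (hv m) (hw m) hα0₁ (hα₁𝔣 m) hαv₁ hσ ht₁𝔪 (s m)).mpr (hs₁ m)
    have dσ₂ := (artin_mem_rayAdicTower_U_iff (h𝔣0 m) (hv m) (hw m) hα0₂ (hα₂𝔣 m) hαv₂ hτ' ht₂𝔪 (s m)).mpr (hs₂ m)
    have dgen := hgen_artin (h𝔣0 m) (h𝔣0 m) (hv m) (hw m) e₂ le_rfl (hv m) hα0₁ (hα₁𝔣 m) hαv₁ hσ ht₁𝔪 (hs₁ m) (hs₁' m) hp2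
    have dpow := hpow_artin (h𝔣0 m) (h𝔣0 m) (hv m) (hw m) e₂ le_rfl (hv m) hα0₁ (hα₁𝔣 m) hαv₁ hσ ht₁𝔪 (hs₁ m) (hs₁' m) hp2
    have dunb := hunb_artin (h𝔣0 m) (h𝔣0 m) (hv m) (hw m) e₂ le_rfl (hv m) hα0₁ (hα₁𝔣 m) hαv₁ hσ ht₁𝔪 (hs₁ m) (hs₁' m) hp2
    have dτ := hτ_artin (h𝔣0 m) (h𝔣0 m) (hv m) (hw m) e₂ le_rfl (hv m) hα0₁ (hα₁𝔣 m) hαv₁ hα0₂ (hα₂𝔣 m) hαv₂ hσ hτ' ht₁𝔪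
      ht₂𝔪 (hne m) (s m)
    -- any two lifts of the same Artin symbols have the same cells in `Γ_K ⧸ Gal(K̄/K(𝔣_m v^{n+1}))`
    have habs : ∀ (i : I) (t : ↥(absRestrictNormalHom (rayClassField K (𝔣 m))).ker),
        (∀ k : ℕ, absRestrictNormalHom (rayClassField K (𝔣 m * v.asIdeal ^ (k + 1))) (t : absoluteGaloisGroup K) =
          artinSymbol (galFrob K (rayClassField K (𝔣 m * v.asIdeal ^ (k + 1)))) (idl i)) →
        ∀ n, (absRayAdicTower (𝔪' := 𝔣 m) (h𝔣0 m) v).proj n (g i) =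
          (absRayAdicTower (𝔪' := 𝔣 m) (h𝔣0 m) v).proj n (t : absoluteGaloisGroup K) :=
      fun i t ht n ↦ (absRayAdicTower (𝔪' := 𝔣 m) (h𝔣0 m) v).proj_eq_of_map_eq
        (absRestrictNormalHom (rayClassField K (𝔣 m * v.asIdeal ^ (n + 1)))) rfl ((hg i m n).trans (ht n).symm)
    have hmem : ∀ (i : I) (t : ↥(absRestrictNormalHom (rayClassField K (𝔣 m))).ker),
        (∀ k : ℕ, absRestrictNormalHom (rayClassField K (𝔣 m * v.asIdeal ^ (k + 1))) (t : absoluteGaloisGroup K) =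
          artinSymbol (galFrob K (rayClassField K (𝔣 m * v.asIdeal ^ (k + 1)))) (idl i)) →
        g i ∈ (absRestrictNormalHom (rayClassField K (𝔣 m))).ker := by
      intro i t ht
      have h0 : (g i)⁻¹ * (t : absoluteGaloisGroup K) ∈ (absRestrictNormalHom (rayClassField K (𝔣 m))).ker :=
        absRayAdicTower_U_le_ker (h𝔣0 m) v le_rfl 0 (((absRayAdicTower (𝔪' := 𝔣 m) (h𝔣0 m) v).proj_eq_iff).mp (habs i t ht 0))
      have h1 : g i = (t : absoluteGaloisGroup K) * ((g i)⁻¹ * (t : absoluteGaloisGroup K))⁻¹ := by group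
      rw [h1]
      exact Subgroup.mul_mem _ t.2 (Subgroup.inv_mem _ h0)
    have hg₁H := hmem (a₁ m) ⟨t₁, ht₁𝔪⟩ ht₁
    have hg₂H := hmem (a₂ m) ⟨t₂, ht₂𝔪⟩ ht₂
    have hrel₁ : ∀ n, (rayAdicTower (𝔪 := 𝔣 m) (h𝔣0 m) v).proj n
        (⟨g (a₁ m), hg₁H⟩ : ↥(absRestrictNormalHom (rayClassField K (𝔣 m))).ker) =
        (rayAdicTower (𝔪 := 𝔣 m) (h𝔣0 m) v).proj n ⟨t₁, ht₁𝔪⟩ :=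
      fun n ↦ (proj_coe_eq_iff (𝒰 := absRayAdicTower (𝔪' := 𝔣 m) (h𝔣0 m) v) (𝒱 := rayAdicTower (𝔪 := 𝔣 m) (h𝔣0 m) v)
        (fun n ↦ rayAdicTower_U_eq_subgroupOf (𝔪 := 𝔣 m) (h𝔣0 m) v n)).mp (habs (a₁ m) ⟨t₁, ht₁𝔪⟩ ht₁ n)
    have hrel₂ : ∀ n, (rayAdicTower (𝔪 := 𝔣 m) (h𝔣0 m) v).proj n
        (⟨g (a₂ m), hg₂H⟩ : ↥(absRestrictNormalHom (rayClassField K (𝔣 m))).ker) =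
        (rayAdicTower (𝔪 := 𝔣 m) (h𝔣0 m) v).proj n ⟨t₂, ht₂𝔪⟩ :=
      fun n ↦ (proj_coe_eq_iff (𝒰 := absRayAdicTower (𝔪' := 𝔣 m) (h𝔣0 m) v) (𝒱 := rayAdicTower (𝔪 := 𝔣 m) (h𝔣0 m) v)
        (fun n ↦ rayAdicTower_U_eq_subgroupOf (𝔪 := 𝔣 m) (h𝔣0 m) v n)).mp (habs (a₂ m) ⟨t₂, ht₂𝔪⟩ ht₂ n)
    exact ⟨hg₁H, hg₂H, ((rayAdicTower (𝔪 := 𝔣 m) (h𝔣0 m) v).mem_U_iff_of_forall_proj_eq hrel₁ (s m)).mpr dσ₁,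
      ((rayAdicTower (𝔪 := 𝔣 m) (h𝔣0 m) v).mem_U_iff_of_forall_proj_eq hrel₂ (s m)).mpr dσ₂,
      (rayAdicTower (𝔪 := 𝔣 m) (h𝔣0 m) v).hgen_of_forall_proj_eq hrel₁ dgen,
      (rayAdicTower (𝔪 := 𝔣 m) (h𝔣0 m) v).hpow_of_forall_proj_eq hrel₁ dpow,
      (rayAdicTower (𝔪 := 𝔣 m) (h𝔣0 m) v).hunb_of_forall_proj_eq hrel₁ dunb,
      (rayAdicTower (𝔪 := 𝔣 m) (h𝔣0 m) v).hτ_of_forall_proj_eq hrel₁ hrel₂ dτ⟩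
  choose hg₁H hg₂H hσ₁ hσ₂ hgen hpow hunb hτ using key
  exact exists_twoVariable_groupDistribution_ellipticUnitsGlobal_steps h24ii h24iii h25 hK ι 𝔣 hle h𝔣0 h𝔣1 hv hw hq h2 u hσ₀ hε
    θ hθ1 e₂ hΘe α hα0 hα𝔣 hαw f hαπ E hE hdegE hEE j hj hjC hjj ψ hψ idl hidl0 hidlc g hg x hx hstep s a₁ a₂ hg₁H hg₂H hσ₁ hσ₂ hgen
    hpow hunb hN1 h4 hN12 hτ c₀ hNc₀

end Summit.BirchSwinnertonDyer.BirchSwinnertonDyer.Theorems.PrintCf2.EllipticUnitsTwoVariable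

end
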